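import Summits.CriticalPhenomena.CardyFormulaZ2.Theses.CardyExpCovariance
import Literature.Probability.Percolation.InterfaceScalingLimitDiscretised
import Literature.Probability.Percolation.BoxCrossingJordan
import Literature.Probability.RandomPlanarGeometry.ChordalCurveFamily
import Literature.Probability.RandomPlanarGeometry.SLESixCrossingNondegenerate
import Literature.Probability.RandomPlanarGeometry.CritPercSLELocalityProofs
import Literature.Probability.RandomPlanarGeometry.CritPercSLELocalityItoProofs
import Literature.Probability.RandomPlanarGeometry.CritPercSLESimplePathHolds
import Literature.Probability.RandomPlanarGeometry.ConformalMapCaratheodoryProofs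
import Literature.Probability.RandomPlanarGeometry.SLETargetIndependenceSix
import Literature.Probability.RandomPlanarGeometry.SLEExistenceNeEightHolds
import Literature.Probability.RandomPlanarGeometry.SLEUniquenessInLaw
import Summits.CriticalPhenomena.CardyFormulaZ2.Theorems.CardyViaSLE6Assembly
import Summits.CriticalPhenomena.CardyFormulaZ2.Theorems.CardySelfRefinementLagHandOffDiscretisable
import Literature.Probability.Percolation.BondInterfaceMeasurability
import Literature.Probability.RandomPlanarGeometry.LocalMartingaleProofs
import Literature.Probability.RandomPlanarGeometry.StopAtShrinking

/-!
# Line `split-skeleton` — REGISTERED skeleton of the crux `CardyRigiditySeq` (stmt-CriticalPhenomena-4680) along its typed split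

Route `CardyExpCovariance`, sub-problem `CardyFormulaZ2`; crux (rank 3)

    CardyRigiditySeq : ∀ u f, u_k → 0⁺ → (∀ R φ x, R.IsUniformizing φ x → P_{1/2}(R, u_k) → f (crossRatio x)) →
      EqOn f cardyFunction (Ioo 0 1)

("if along ONE mesh sequence the bond-ℤ² crossing probabilities of every conformal rectangle converge
to a kernel `f` of the cross-ratio, then `f = F`").  The crux strategist's typed decomposition (BC2
redirect of the RESTATED re-audit, 2026-08-17)

    CardyRigiditySeq ⇐ SeqKernelForcesSLE (X₁) ∧ SeqCrossingReadout (X₂) ∧ SeqLimitTargetIndependent (X₃)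

is assembled here into ONE self-contained registered line of the parent crux (crux workfiles under
`Cruxes/**/Lines/` are not built as importable modules on the farm, so the published pieces
`Lines/split_glue.lean`, `Lines/birth_SeqKernelForcesSLE.lean`, `Lines/birth_SeqCrossingReadout.lean`,
`Lines/birth_SeqLimitTargetIndependent.lean` are reproduced verbatim below, each in its own namespace):

* Part G (`SplitSkeleton.Glue`) — the ASSEMBLY `X₁ → X₂ → X₃ → CardyRigiditySeq`, PROVED (≈ 45 tactic
  lines; conclusion written as the crux body unfolded so that the skeleton audit sees exactly one
  by-name candidate): `κ > 4` by RSW cluster points along `u` versus the Rohde–Schramm simple phase,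
  `κ = 6` by the Lawler–Schramm–Werner target-independence characterisation (tree theorem
  `eq_six_of_isSLELaw_of_isTargetIndependent_of_four_lt`), `f = F` by Cardy's formula for SLE₆
  (`sle_six_measureReal_hitsBefore_holds`) read through X₂;
* Part X₁ (`BirthSeqKernelForcesSLE`) — stubs `stub_subseqLimitLaw` (tightness, M/L) and
  `stub_subseqLimitIsSLE` (identification of every subsequential limit as THE SLE_κ law through the
  unknown kernel; XL, the heart) ⟹ X₁ (proved: subsequence principle + uniqueness of the SLE_κ law);
* Part X₂ (`BirthSeqCrossingReadout`) — the SHARED open items `CardyViaSLE6.InterfaceImpliesCrossing`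
  (stmt-11317) and `CardyViaSLE6.CrossingImpliesInterface` (stmt-11318) BY NAME + stubs
  `stub_hitsBeforeUpperApprox` (M), `stub_sleTargetSideApprox` (M/L) ⟹ X₂ (proved: open-set portmanteau
  along `atTop` + a 4ε sandwich);
* Part X₃ (`BirthSeqLimitTargetIndependent`) — stubs `stub_handsOffThickSplitting` (exact lattice
  splitting for hands-off discretisation pairs, M/L) and `stub_stoppedLawsConverge` (stopped laws
  converge at a.e. thickening level, L) ⟹ X₃ (proved, ≈ 90 lines);
* `SplitSkeleton.CardyRigiditySeq_of` — the six stubs and the two shared items imply the crux BY NAME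
  (real proof: the three piece compositions fed into Part G).

Stubs (6): `stub_subseqLimitLaw`, `stub_subseqLimitIsSLE` (hardest), `stub_hitsBeforeUpperApprox`,
`stub_sleTargetSideApprox`, `stub_handsOffThickSplitting`, `stub_stoppedLawsConverge`; by-name open
items (2): stmt-11317, stmt-11318.  The ONLY `sorry`s of this file are the six `Holds.stub_*`.

Context (tree, 2026-08-17T03:07Z): `Theorems/CardyBoundaryCoulombGasHalfPlaneMarkDensityLawSubseqRigidityCorollaries`
proves `cardyRigiditySeq_of_halfPlaneMarkDensityLaw : HalfPlaneMarkDensityLaw → CardyRigiditySeq`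
(stmt-5661 ⟹ this crux) and `cardyRigiditySeq_of_cardyFormulaZ2 : CardyFormulaZ2 → CardyRigiditySeq`;
this line is the INDEPENDENT SLE route to the same crux (no half-plane Cardy value needed; κ is derived,
not assumed).  Negatives honoured: stmt-0698 (`not_SymmetryUpgrade`) is not instantiated — every
hypothesis is about genuine sequential scaling limits of the bond-ℤ² interface; stmt-0748 is used
positively (RSW).
-/

section SplitSkeletonGluePart

open scoped NNReal Topology
open MeasureTheory Filter Set
open UpperHalfPlane (upperHalfPlaneSet)
open Literature.Probability.RandomPlanarGeometry Literature.Probability.LatticeModels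
open Literature.Probability.Percolation hiding cardyFunction

namespace Summit.CriticalPhenomena.CardyFormulaZ2.Cruxes.CardyRigiditySeq.SplitSkeleton.Glue

/-- **`CardyRigiditySeq` from its three pieces** (`SeqKernelForcesSLE → SeqCrossingReadout →
SeqLimitTargetIndependent → CardyRigiditySeq`, statements inlined verbatim in this order; see the
module docstring for the proof).  Glue theorem of the split of stmt-CriticalPhenomena-4680 on route
`CardyExpCovariance`. -/
theorem cardyRigiditySeq_of_subs_unfolded :
    (∀ (u : ℕ → ℝ) (f : ℝ → ℝ), Filter.Tendsto u Filter.atTop (nhdsWithin 0 (Set.Ioi 0)) → (∀ (R : Literature.Probability.RandomPlanarGeometry.ConformalRectangle) (φ : Literature.Probability.RandomPlanarGeometry.ConformalEquiv UpperHalfPlane.upperHalfPlaneSet R.carrier) (x : Fin 4 → ℝ), R.IsUniformizing φ x → Filter.Tendsto (fun k ↦ Literature.Probability.Percolation.bondDomainCrossingProb R (u k)) Filter.atTop (nhds (f (Literature.Probability.RandomPlanarGeometry.crossRatio x)))) → ∃ κ : NNReal, 0 < κ ∧ ∀ (D : Literature.Probability.RandomPlanarGeometry.DobrushinDomain) (E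 : ℝ → Literature.Probability.LatticeModels.DiscreteDobrushin), Literature.Probability.LatticeModels.ZdDiscretisationFamily D E → ∃ Γ : (NNReal → ℝ) → Literature.Probability.RandomPlanarGeometry.CurveClass ℂ, Literature.Probability.RandomPlanarGeometry.IsSLECurve κ D Γ ∧ ∀ g : BoundedContinuousFunction (Literature.Probability.RandomPlanarGeometry.CurveClass ℂ) ℝ, Filter.Tendsto (fun k ↦ ∫ ω, g (Literature.Probability.Percolation.bondInterfaceIn D (E (u k)) ω) ∂(Literature.Probability.Percolation.bondPercolation (Literature.Probability.LatticeModels.zdGraph 2) Literature.Probability.Percolation.half)) Filter.atTop (nhds (∫ ω, g (Γ ω) ∂Literature.Probability.Process.preWienerMeasure))) →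
    (∀ (u : ℕ → ℝ) (f : ℝ → ℝ) (κ : NNReal), 0 < κ → Filter.Tendsto u Filter.atTop (nhdsWithin 0 (Set.Ioi 0)) → (∀ (R : Literature.Probability.RandomPlanarGeometry.ConformalRectangle) (φ : Literature.Probability.RandomPlanarGeometry.ConformalEquiv UpperHalfPlane.upperHalfPlaneSet R.carrier) (x : Fin 4 → ℝ), R.IsUniformizing φ x → Filter.Tendsto (fun k ↦ Literature.Probability.Percolation.bondDomainCrossingProb R (u k)) Filter.atTop (nhds (f (Literature.Probability.RandomPlanarGeometry.crossRatio x)))) → (∀ (D : Literature.Probability.RandomPlanarGeometry.DobrushinDomain) (E : ℝ → Literature.Probability.LatticeModels.DiscreteDobrushin), Literature.Probability.LatticeModels.ZdDiscretisationFamily D E → ∃ Γ : (NNReal → ℝ) → Literature.Probability.RandomPlanarGeometry.CurveClass ℂ, Literature.Probability.RandomPlanarGeometry.IsSLECurve κ D Γ ∧ ∀ g : BoundedContinuousFunction (Literature.Probability.RandomPlanarGeometry.CurveClass ℂ) ℝ, Filter.Tendsto (fun k ↦ ∫ ω, g (Literature.Probability.Percolation.bondInterfaceIn D (E (u k)) ω)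 ∂(Literature.Probability.Percolation.bondPercolation (Literature.Probability.LatticeModels.zdGraph 2) Literature.Probability.Percolation.half)) Filter.atTop (nhds (∫ ω, g (Γ ω) ∂Literature.Probability.Process.preWienerMeasure))) → ∀ (R : Literature.Probability.RandomPlanarGeometry.ConformalRectangle) (μ : MeasureTheory.Measure (Literature.Probability.RandomPlanarGeometry.CurveClass ℂ)) (φ : Literature.Probability.RandomPlanarGeometry.ConformalEquiv UpperHalfPlane.upperHalfPlaneSet R.carrier) (x : Fin 4 → ℝ), Literature.Probability.RandomPlanarGeometry.IsSLELaw κ (R.chord 0 2 (by decide)) μ → R.IsUniformizing φ x → μ.real (Literature.Probability.RandomPlanarGeometry.CurveClass.hitsBefore (R.arc 2) (R.arc 1)) = f (Literature.Probability.RandomPlanarGeometry.crossRatio x)) →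
    (∀ (u : ℕ → ℝ) (κ : NNReal), 0 < κ → Filter.Tendsto u Filter.atTop (nhdsWithin 0 (Set.Ioi 0)) → (∀ (D : Literature.Probability.RandomPlanarGeometry.DobrushinDomain) (E : ℝ → Literature.Probability.LatticeModels.DiscreteDobrushin), Literature.Probability.LatticeModels.ZdDiscretisationFamily D E → ∃ Γ : (NNReal → ℝ) → Literature.Probability.RandomPlanarGeometry.CurveClass ℂ, Literature.Probability.RandomPlanarGeometry.IsSLECurve κ D Γ ∧ ∀ g : BoundedContinuousFunction (Literature.Probability.RandomPlanarGeometry.CurveClass ℂ) ℝ, Filter.Tendsto (fun k ↦ ∫ ω, g (Literature.Probability.Percolation.bondInterfaceIn D (E (u k)) ω) ∂(Literature.Probability.Percolation.bondPercolation (Literature.Probability.LatticeModels.zdGraph 2) Literature.Probability.Percolation.half)) Filter.atTop (nhds (∫ ω, g (Γ ω) ∂Literature.Probability.Process.preWienerMeasure))) → ∃ Q : Literature.Probability.RandomPlanarGeometry.ChordalFamily, (∀ D : Literature.Probability.RandomPlanarGeometry.DobrushinDomain, Literature.Probability.RandomPlanarGeometry.IsSLELaw κ D (Q D)) ∧ Q.IsTargetIndependent)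 →
    -- the crux `CardyExpCovariance.CardyRigiditySeq`, UNFOLDED verbatim (the by-name conclusion is reserved
    -- to the skeleton theorem `SplitSkeleton.CardyRigiditySeq_of` below; by-name twin: Lines/split_glue.lean)
    (∀ (u : ℕ → ℝ) (f : ℝ → ℝ), Filter.Tendsto u Filter.atTop (nhdsWithin 0 (Set.Ioi 0)) → (∀ (R : Literature.Probability.RandomPlanarGeometry.ConformalRectangle) (φ : Literature.Probability.RandomPlanarGeometry.ConformalEquiv UpperHalfPlane.upperHalfPlaneSet R.carrier) (x : Fin 4 → ℝ), R.IsUniformizing φ x → Filter.Tendsto (fun k ↦ Literature.Probability.Percolation.bondDomainCrossingProb R (u k)) Filter.atTop (nhds (f (Literature.Probability.RandomPlanarGeometry.crossRatio x)))) → Set.EqOn f Literature.Probability.RandomPlanarGeometry.cardyFunction (Set.Ioo 0 1)) := by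
  intro hA hB hC u f hu hf η hη
  -- X₁: along `u` the interfaces converge to SLE_κ for one κ > 0
  obtain ⟨κ, hκ, hlim⟩ := hA u f hu hf
  -- X₃: a target-independent family of SLE_κ laws
  obtain ⟨Q, hQ, hT⟩ := hC u κ hκ hu hlim
  -- κ > 4 (Rohde–Schramm simple phase versus RSW non-degeneracy along the sequence `u`)
  have h4 : 4 < κ := by
    refine lt_of_not_ge fun hle ↦ ?_
    set R₀ : ConformalRectangle := ConformalRectangle.unitDisc
    obtain ⟨φ₀, x₀, hφ₀⟩ := MarkedDomain.exists_isUniformizing_holds R₀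
    have hμ₀ : IsSLELaw κ (R₀.chord 0 2 (by decide)) (Q (R₀.chord 0 2 (by decide))) := hQ _
    have hzero :
        (Q (R₀.chord 0 2 (by decide))).real (CurveClass.hitsBefore (R₀.arc 2) (R₀.arc 1)) = 0 :=
      measureReal_hitsBefore_eq_zero_of_le_four
        (fun κ ↦ ae_isSimpleTrace_sleTrace_of_le_four_holds (κ := κ))
        JordanDomain.exists_continuousOn_extension_holds hκ hle R₀ hμ₀
    have hker₀ := hB u f κ hκ hu hf hlim R₀ _ φ₀ x₀ hμ₀ hφ₀
    have hf0 : f (crossRatio x₀) = 0 := hker₀.symm.trans hzero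
    -- along `u` the crossing probabilities of `R₀` tend to `f (crossRatio x₀) = 0` …
    have htend : Tendsto (fun k ↦ bondDomainCrossingProb R₀ (u k)) atTop (𝓝 0) := by
      simpa only [hf0] using hf R₀ φ₀ x₀ hφ₀
    -- … so `0` is a cluster point of them along `𝓝[>] 0`, contradicting RSW
    have hseq : MapClusterPt (0 : ℝ) atTop
        ((fun δ ↦ discreteCrossingProb half R₀.carrier δ (R₀.arc 0) (R₀.arc 2)) ∘ u) :=
      htend.mapClusterPt
    have hclu : MapClusterPt (0 : ℝ) (𝓝[>] (0 : ℝ))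
        (fun δ ↦ discreteCrossingProb half R₀.carrier δ (R₀.arc 0) (R₀.arc 2)) :=
      hseq.of_comp hu
    exact (lt_irrefl (0 : ℝ)) (discreteCrossingProb_clusterPt_mem_Ioo_holds R₀ hclu).1
  -- Lawler–Schramm–Werner: a target-independent family of SLE_κ laws with κ > 4 has κ = 6
  have h6 : κ = 6 :=
    eq_six_of_isSLELaw_of_isTargetIndependent_of_four_lt h4 hQ hT
      (ConformalRectangle.unitDisc.restrictMarks (Fin.castSuccOrderEmb (n := 3)))
  subst h6
  -- realise `η` as the modulus of a rectangle carrying an SLE₆ law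
  have hs : cardyFunction η ∈ Ioo (0 : ℝ) 1 := cardyFunction_mem_Ioo hη
  obtain ⟨R, μ, φ, x, hμ, hφ, hval⟩ :=
    exists_isSLELaw_cardyFunction_crossRatio_eq_at (κ := 6) exists_isSLECurve_six hs
  have hx : crossRatio x ∈ Ioo (0 : ℝ) 1 :=
    ConformalRectangle.crossRatio_mem_Ioo_of_isUniformizing hφ
  have hmono : StrictMonoOn cardyFunction (Icc 0 1) := strictMonoOn_cardyFunction_holds
  have hxη : crossRatio x = η :=
    hmono.injOn ⟨hx.1.le, hx.2.le⟩ ⟨hη.1.le, hη.2.le⟩ hval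
  -- X₂ at κ = 6: `f (crossRatio x)` is the SLE₆ crossing probability, `= F (crossRatio x)`
  have hker : μ.real (CurveClass.hitsBefore (R.arc 2) (R.arc 1)) = f (crossRatio x) :=
    hB u f 6 hκ hu hf hlim R μ φ x hμ hφ
  have hcardy : μ.real (CurveClass.hitsBefore (R.arc 2) (R.arc 1)) = cardyFunction (crossRatio x) :=
    sle_six_measureReal_hitsBefore_holds R hμ hφ
  rw [← hxη, ← hker, hcardy]


end Summit.CriticalPhenomena.CardyFormulaZ2.Cruxes.CardyRigiditySeq.SplitSkeleton.Glue

end SplitSkeletonGluePart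

/-!
# Birth skeleton (BC3) for piece X₁ `SeqKernelForcesSLE` of the split of `CardyRigiditySeq` (stmt-CriticalPhenomena-4680)

Route `CardyExpCovariance`; the piece is filed by the crux strategist as a child of the crux
`CardyRigiditySeq` (children.json of the split; the route decl does not exist yet, so the piece is
restated verbatim here as `SeqKernelForcesSLE`).

    SeqKernelForcesSLE := ∀ u f, u_k → 0⁺ → HYPSEQ u f → ∃ κ > 0, LIMSEQ κ u

(`HYPSEQ u f`: along the mesh sequence `u` the bond-ℤ² crossing probabilities of every conformal
rectangle converge to `f (cross-ratio)`; `LIMSEQ κ u`: for every Dobrushin domain and every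
admissible discretisation family the medial exploration interface converges in law ALONG `u`
(bounded continuous test functions on `CurveClass ℂ`) to a chordal SLE_κ random curve.)

The line (Camia–Newman 2007 §§5–7 / Smirnov 2001 Thm 2, run with an UNKNOWN kernel along ONE
sequence) cut along its two classical halves:

* `stub_subseqLimitLaw` (TIGHTNESS, size M/L): along every subsequence of `u` a further
  subsequence of the interface laws converges (portmanteau sense) to SOME Borel measure on
  `CurveClass ℂ` — Aizenman–Burchard tightness for admissible families (the tree fact
  `isTightLaws_map_bondInterface` covers the canonical data) + Prokhorov on the curve space.
* `stub_subseqLimitIsSLE` (IDENTIFICATION, size XL — the heart): under `HYPSEQ u f` there is ONE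
  `κ > 0` such that every such subsequential limit law, in every Dobrushin domain and for every
  admissible family, is the chordal SLE_κ law (the kernel `f` fixes the exit distributions of the
  limit; conformal invariance of `f` + discrete domain Markov passed to the limit + Schramm's
  principle).

Composition `SeqKernelForcesSLE_of` (real proof): subsequence principle
(`Filter.tendsto_of_subseq_tendsto`, `Filter.strictMono_subseq_of_tendsto_atTop`) + uniqueness of
the chordal SLE_κ law (`IsSLELaw.unique` with the PROVED `IsSLECurve.map_eq_holds`) +
`integral_map`: all subsequential limits are the same SLE_κ law, so the whole sequence converges to
the law of one SLE_κ random curve `Γ`.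
-/

noncomputable section

namespace Summit.CriticalPhenomena.CardyFormulaZ2.Cruxes.CardyRigiditySeq.BirthSeqKernelForcesSLE

open scoped NNReal Topology
open MeasureTheory Filter Set
open Literature.Probability.RandomPlanarGeometry Literature.Probability.LatticeModels

/-- Piece X₁ of the split of `CardyRigiditySeq`, restated VERBATIM from the strategist's
children.json (the route decl `Theses.CardyExpCovariance.SeqKernelForcesSLE` is written by the gate
when the split is applied). -/
def SeqKernelForcesSLE : Prop :=
  ∀ (u : ℕ → ℝ) (f : ℝ → ℝ), Filter.Tendsto u Filter.atTop (nhdsWithin 0 (Set.Ioi 0)) → (∀ (R : Literature.Probability.RandomPlanarGeometry.ConformalRectangle) (φ : Literature.Probability.RandomPlanarGeometry.ConformalEquiv UpperHalfPlane.upperHalfPlaneSet R.carrier) (x : Fin 4 → ℝ), R.IsUniformizing φ x → Filter.Tendsto (fun k ↦ Literature.Probability.Percolation.bondDomainCrossingProb R (u k)) Filter.atTop (nhds (f (Literature.Probability.RandomPlanarGeometry.crossRatio x)))) → ∃ κ : NNReal, 0 < κ ∧ ∀ (D : Literature.Probability.RandomPlanarGeometry.DobrushinDomain) (E : ℝ →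 Literature.Probability.LatticeModels.DiscreteDobrushin), Literature.Probability.LatticeModels.ZdDiscretisationFamily D E → ∃ Γ : (NNReal → ℝ) → Literature.Probability.RandomPlanarGeometry.CurveClass ℂ, Literature.Probability.RandomPlanarGeometry.IsSLECurve κ D Γ ∧ ∀ g : BoundedContinuousFunction (Literature.Probability.RandomPlanarGeometry.CurveClass ℂ) ℝ, Filter.Tendsto (fun k ↦ ∫ ω, g (Literature.Probability.Percolation.bondInterfaceIn D (E (u k)) ω) ∂(Literature.Probability.Percolation.bondPercolation (Literature.Probability.LatticeModels.zdGraph 2) Literature.Probability.Percolation.half)) Filter.atTop (nhds (∫ ω, g (Γ ω) ∂Literature.Probability.Process.preWienerMeasure))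

/-- STUB T — **tightness / subsequential limit laws along admissible families** (Aizenman–Burchard
1999 Thm 1.2 + Prokhorov; size M/L). -/
protected theorem Holds.stub_subseqLimitLaw :
    ∀ (u : ℕ → ℝ), Filter.Tendsto u Filter.atTop (nhdsWithin 0 (Set.Ioi 0)) → ∀ (D : Literature.Probability.RandomPlanarGeometry.DobrushinDomain) (E : ℝ → Literature.Probability.LatticeModels.DiscreteDobrushin), Literature.Probability.LatticeModels.ZdDiscretisationFamily D E → ∀ ψ : ℕ → ℕ, StrictMono ψ → ∃ φ' : ℕ → ℕ, StrictMono φ' ∧ ∃ P : MeasureTheory.Measure (Literature.Probability.RandomPlanarGeometry.CurveClass ℂ), ∀ g : BoundedContinuousFunction (Literature.Probability.RandomPlanarGeometry.CurveClass ℂ) ℝ, Filter.Tendsto (fun k ↦ ∫ ω, g (Literature.Probability.Percolation.bondInterfaceIn D (E (u (ψ (φ' k)))) ω) ∂(Literature.Probability.Percolation.bondPercolation (Literature.Probability.LatticeModels.zdGraph 2) Literature.Probability.Percolation.half)) Filter.atTop (nhds (∫ γ, g γ ∂P)) := by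
  sorry

/-- By-name handle of the registered stub `Holds.stub_subseqLimitLaw` (D-0027 §3.3 device). -/
def stub_subseqLimitLaw : Prop := type_of% Holds.stub_subseqLimitLaw

/-- STUB I — **identification of every subsequential limit as THE SLE_κ law, one κ for all**
(Camia–Newman 2007 §§5–7 / Smirnov 2001 Thm 2 with an unknown conformally invariant kernel;
Schramm 2000 §1.5; size XL, the heart of the piece). -/
protected theorem Holds.stub_subseqLimitIsSLE :
    ∀ (u : ℕ → ℝ) (f : ℝ → ℝ), Filter.Tendsto u Filter.atTop (nhdsWithin 0 (Set.Ioi 0)) → (∀ (R : Literature.Probability.RandomPlanarGeometry.ConformalRectangle) (φ : Literature.Probability.RandomPlanarGeometry.ConformalEquiv UpperHalfPlane.upperHalfPlaneSet R.carrier) (x : Fin 4 → ℝ), R.IsUniformizing φ x → Filter.Tendsto (fun k ↦ Literature.Probability.Percolation.bondDomainCrossingProb R (u k)) Filter.atTop (nhds (f (Literature.Probability.RandomPlanarGeometry.crossRatio x)))) → ∃ κ : NNReal, 0 < κ ∧ ∀ (D : Literature.Probability.RandomPlanarGeometry.DobrushinDomain) (E : ℝ → Literature.Probability.LatticeModels.DiscreteDobrushin),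 Literature.Probability.LatticeModels.ZdDiscretisationFamily D E → ∀ ψ : ℕ → ℕ, StrictMono ψ → ∀ P : MeasureTheory.Measure (Literature.Probability.RandomPlanarGeometry.CurveClass ℂ), (∀ g : BoundedContinuousFunction (Literature.Probability.RandomPlanarGeometry.CurveClass ℂ) ℝ, Filter.Tendsto (fun k ↦ ∫ ω, g (Literature.Probability.Percolation.bondInterfaceIn D (E (u (ψ k))) ω) ∂(Literature.Probability.Percolation.bondPercolation (Literature.Probability.LatticeModels.zdGraph 2) Literature.Probability.Percolation.half)) Filter.atTop (nhds (∫ γ, g γ ∂P))) → Literature.Probability.RandomPlanarGeometry.IsSLELaw κ D P := by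
  sorry

/-- By-name handle of the registered stub `Holds.stub_subseqLimitIsSLE` (D-0027 §3.3 device). -/
def stub_subseqLimitIsSLE : Prop := type_of% Holds.stub_subseqLimitIsSLE

/-- **Composition (real proof):** tightness + identification give full convergence along `u` to
one SLE_κ random curve, i.e. the piece `SeqKernelForcesSLE` BY NAME. -/
theorem SeqKernelForcesSLE_of : stub_subseqLimitLaw → stub_subseqLimitIsSLE → SeqKernelForcesSLE := by
  intro hT hI
  dsimp only [stub_subseqLimitLaw, stub_subseqLimitIsSLE] at hT hI
  intro u f hu hf
  obtain ⟨κ, hκ, hid⟩ := hI u f hu hf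
  refine ⟨κ, hκ, fun D E hE ↦ ?_⟩
  -- a first subsequential limit law, identified as an SLE_κ law: this fixes the limit curve `Γ`
  obtain ⟨φ₀, hφ₀, P₀, hconv₀⟩ := hT u hu D E hE id strictMono_id
  have hsle₀ : IsSLELaw κ D P₀ := hid D E hE (id ∘ φ₀) (strictMono_id.comp hφ₀) P₀ hconv₀
  obtain ⟨Γ, hΓ, rfl⟩ := hsle₀
  refine ⟨Γ, hΓ, fun g ↦ ?_⟩
  -- every subsequence has a further subsequence along which the integrals converge to the SAME
  -- value `∫ g ∘ Γ dW` (uniqueness of the SLE_κ law), hence the whole sequence converges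
  refine tendsto_of_subseq_tendsto fun ns hns ↦ ?_
  obtain ⟨φ, hφ, hmono⟩ := strictMono_subseq_of_tendsto_atTop hns
  obtain ⟨φ', hφ', P, hconv⟩ := hT u hu D E hE (ns ∘ φ) hmono
  have hsle : IsSLELaw κ D P := hid D E hE ((ns ∘ φ) ∘ φ') (hmono.comp hφ') P hconv
  have hPeq : P = Literature.Probability.Process.preWienerMeasure.map Γ :=
    IsSLELaw.unique IsSLECurve.map_eq_holds hsle hΓ.isSLELaw_map
  refine ⟨φ ∘ φ', ?_⟩
  have h := hconv g
  rw [hPeq, integral_map hΓ.aemeasurable g.continuous.aestronglyMeasurable] at h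
  simpa [Function.comp_def] using h

/-- The piece, conditionally on the two registered stubs (the only `sorry`s of this file are
inside `Holds.stub_*`); certifies that the handles ARE the stub statements. -/
theorem seqKernelForcesSLE_of_stubs : SeqKernelForcesSLE :=
  SeqKernelForcesSLE_of Holds.stub_subseqLimitLaw Holds.stub_subseqLimitIsSLE

end Summit.CriticalPhenomena.CardyFormulaZ2.Cruxes.CardyRigiditySeq.BirthSeqKernelForcesSLE

end

/-!
# Birth skeleton (BC3) for piece X₂ `SeqCrossingReadout` of the split of `CardyRigiditySeq` (stmt-CriticalPhenomena-4680)

Route `CardyExpCovariance`; the piece is a child of the crux `CardyRigiditySeq` in the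
strategist's children.json (restated verbatim here, the route decl does not exist yet).

    SeqCrossingReadout := ∀ u f κ, 0 < κ → u_k → 0⁺ → HYPSEQ u f → LIMSEQ κ u →
      ∀ R μ φ x, IsSLELaw κ (R.chord 0 2) μ → R.IsUniformizing φ x →
        μ.real (hitsBefore (R.arc 2) (R.arc 1)) = f (crossRatio x)

"the sequential crossing kernel IS the crossing law of the limiting SLE_κ".  The line: the
percolation content is EXACTLY the lattice crossing/interface dictionary already filed (and shared)
on route `CardyViaSLE6` — `InterfaceImpliesCrossing` (stmt-CriticalPhenomena-11317) and
`CrossingImpliesInterface` (stmt-11318), used here BY NAME as hypotheses of the composition — plus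
two regularity lemmas for hitting events that hold for every SLE_κ law (indeed for every finite
Borel measure carried by curves from `a ∉ (bc)` to `c ∈ (bc)`):

* `stub_hitsBeforeUpperApprox` (size M; any finite measure): `μ(hits (cd) before (bc)) ≤
  μ(U(a,b)) + ε` for `b < b₀(ε)` and every `a > 0`, `U(a,b)` = "a-close to `(cd)` at a time up to
  which the curve stayed `> b` away from `(bc)`" (open) — the events
  `{hit (cd) at t, dist(γ[0,t], (bc)) > b}` increase to `hitsBefore` as `b ↓ 0`.
* `stub_sleTargetSideApprox` (size M/L; any `κ > 0`): `μ(univ) ≤ μ(V(b,b')) + μ(hits (cd) before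
  (bc)) + ε` for every `b > 0` and `b' < b₀'(ε, b)`, `V(b,b')` = "b-close to `(bc)` at a time up to
  which the curve stayed `> b'` away from `(cd)`": a curve from `a ∉ (bc)` to `c ∈ (bc)` that is not
  in `⋃_{b'} V(b,b')` touches `(cd)` no later than it first comes `b`-close to `(bc)`, hence strictly
  before it touches `(bc)` — so it is in `hitsBefore` (deterministic curve topology + continuity of
  finite measures; the SLE input is only `γ(0) = a`, `γ(1) = c` a.s.).  Unlike the `κ > 4` sandwich
  `SLE6HittingSandwich` (stmt-8608) the quantifiers are `∀ b ∃ b₀'`, which holds for ALL `κ > 0` and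
  still suffices.

Composition `SeqCrossingReadout_of` (real proof, the measure theory done HERE): an admissible
family `E` of `R.chord 0 2` exists (landed `stub_discretisable`); `LIMSEQ` gives the limit SLE_κ
curve `Γ`, whose law is `μ` by uniqueness of the SLE_κ law (`IsSLELaw.unique`,
`IsSLECurve.map_eq_holds`); the OPEN-SET PORTMANTEAU ALONG `u`
(`eventually_lt_measureReal_preimage_of_tendsto_atTop`, from Mathlib's
`ProbabilityMeasure.le_liminf_measure_open_of_tendsto`) bounds `P(γ_k ∈ U)`, `P(γ_k ∈ V)` below by
`μ U - ε`, `μ V - ε` eventually; `U ∩ V = ∅` (`disjoint_image_hitsBeforeApprox`, landed); the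
dictionary ties `P(γ_k ∈ U)` to `P_0.5(R, u_k)` within `ε`, and `HYPSEQ` ties the latter to
`f (crossRatio x)`; so `|μ(hitsBefore) - f(crossRatio x)| < 4ε` for every `ε`, i.e. equality.
-/

noncomputable section

namespace Summit.CriticalPhenomena.CardyFormulaZ2.Cruxes.CardyRigiditySeq.BirthSeqCrossingReadout

open scoped NNReal Topology ENNReal
open MeasureTheory Filter Set Metric
open Literature.Probability.RandomPlanarGeometry Literature.Probability.LatticeModels
open Literature.Probability.Percolation (bondPercolation half BondConfig measurable_bondInterfaceIn
  bondDomainCrossingProb)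
open Summit.CriticalPhenomena.CardyFormulaZ2.Theses.CardyViaSLE6 (InterfaceImpliesCrossing
  CrossingImpliesInterface)
open Summit.CriticalPhenomena.CardyFormulaZ2.Theorems.CardyViaSLE6 (disjoint_image_hitsBeforeApprox)

/-- Piece X₂ of the split of `CardyRigiditySeq`, restated VERBATIM from the strategist's
children.json. -/
def SeqCrossingReadout : Prop :=
  ∀ (u : ℕ → ℝ) (f : ℝ → ℝ) (κ : NNReal), 0 < κ → Filter.Tendsto u Filter.atTop (nhdsWithin 0 (Set.Ioi 0)) → (∀ (R : Literature.Probability.RandomPlanarGeometry.ConformalRectangle) (φ : Literature.Probability.RandomPlanarGeometry.ConformalEquiv UpperHalfPlane.upperHalfPlaneSet R.carrier) (x : Fin 4 → ℝ), R.IsUniformizing φ x → Filter.Tendsto (fun k ↦ Literature.Probability.Percolation.bondDomainCrossingProb R (u k)) Filter.atTop (nhds (f (Literature.Probability.RandomPlanarGeometry.crossRatio x)))) → (∀ (D : Literature.Probability.RandomPlanarGeometry.DobrushinDomain) (E : ℝ → Literature.Probability.LatticeModels.DiscreteDobrushin), Literature.Probability.LatticeModels.ZdDiscretisationFamily D E →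 ∃ Γ : (NNReal → ℝ) → Literature.Probability.RandomPlanarGeometry.CurveClass ℂ, Literature.Probability.RandomPlanarGeometry.IsSLECurve κ D Γ ∧ ∀ g : BoundedContinuousFunction (Literature.Probability.RandomPlanarGeometry.CurveClass ℂ) ℝ, Filter.Tendsto (fun k ↦ ∫ ω, g (Literature.Probability.Percolation.bondInterfaceIn D (E (u k)) ω) ∂(Literature.Probability.Percolation.bondPercolation (Literature.Probability.LatticeModels.zdGraph 2) Literature.Probability.Percolation.half)) Filter.atTop (nhds (∫ ω, g (Γ ω) ∂Literature.Probability.Process.preWienerMeasure))) → ∀ (R : Literature.Probability.RandomPlanarGeometry.ConformalRectangle) (μ : MeasureTheory.Measure (Literature.Probability.RandomPlanarGeometry.CurveClass ℂ)) (φ : Literature.Probability.RandomPlanarGeometry.ConformalEquiv UpperHalfPlane.upperHalfPlaneSet R.carrier) (x : Fin 4 → ℝ), Literature.Probability.RandomPlanarGeometry.IsSLELaw κ (R.chord 0 2 (by decide)) μ → R.IsUniformizing φ x → μ.real (Literature.Probability.RandomPlanarGeometry.CurveClass.hitsBefore (R.arc 2) (R.arc 1)) = f (Literature.Probability.RandomPlanarGeometry.crossRatio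 x)

/-- STUB U — **upper approximation of the crossing event by the open events `U(a,b)`** (any finite
Borel measure on curve classes; size M). -/
protected theorem Holds.stub_hitsBeforeUpperApprox :
    ∀ (R : Literature.Probability.RandomPlanarGeometry.ConformalRectangle) (μ : MeasureTheory.Measure (Literature.Probability.RandomPlanarGeometry.CurveClass ℂ)), MeasureTheory.IsFiniteMeasure μ → ∀ ε > (0:ℝ), ∃ b₀ > (0:ℝ), ∀ b ∈ Set.Ioo 0 b₀, ∀ a > (0:ℝ), μ.real (Literature.Probability.RandomPlanarGeometry.CurveClass.hitsBefore (R.arc 2) (R.arc 1)) ≤ μ.real (Literature.Probability.RandomPlanarGeometry.CurveClass.mk '' Literature.Probability.RandomPlanarGeometry.CurveClass.hitsBeforeApprox (R.arc 2) (R.arc 1) a b) + ε := by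
  sorry

/-- By-name handle of the registered stub `Holds.stub_hitsBeforeUpperApprox`. -/
def stub_hitsBeforeUpperApprox : Prop := type_of% Holds.stub_hitsBeforeUpperApprox

/-- STUB V — **target-side approximation** for every SLE_κ law, `κ > 0` (curve from `a ∉ (bc)` to
`c ∈ (bc)`; size M/L). -/
protected theorem Holds.stub_sleTargetSideApprox :
    ∀ (κ : NNReal), 0 < κ → ∀ (R : Literature.Probability.RandomPlanarGeometry.ConformalRectangle) (μ : MeasureTheory.Measure (Literature.Probability.RandomPlanarGeometry.CurveClass ℂ)), Literature.Probability.RandomPlanarGeometry.IsSLELaw κ (R.chord 0 2 (by decide)) μ → ∀ ε > (0:ℝ), ∀ b > (0:ℝ), ∃ b₀' > (0:ℝ), ∀ b' ∈ Set.Ioo 0 b₀', μ.real Set.univ ≤ μ.real (Literature.Probability.RandomPlanarGeometry.CurveClass.mk '' Literature.Probability.RandomPlanarGeometry.CurveClass.hitsBeforeApprox (R.arc 1) (R.arc 2) b b') + μ.real (Literature.Probability.RandomPlanarGeometry.CurveClass.hitsBefore (R.arc 2) (R.arc 1)) + ε := by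
  sorry

/-- By-name handle of the registered stub `Holds.stub_sleTargetSideApprox`. -/
def stub_sleTargetSideApprox : Prop := type_of% Holds.stub_sleTargetSideApprox

/-! ### Open-set portmanteau along a sequence -/

/-- **Open-set portmanteau along `atTop`**: if `Y k → Z` in law (bounded continuous test functions)
with `Y k` a.e.-measurable and `Z` a.e.-measurable, then for every open `G` and `ε > 0`,
eventually `Law(Z)(G) - ε < P(Y k ∈ G)` (Billingsley 1999, Thm 2.1; Mathlib's
`ProbabilityMeasure.le_liminf_measure_open_of_tendsto`). -/
theorem eventually_lt_measureReal_preimage_of_tendsto_atTop {Ω Ω' X : Type*} [MeasurableSpace Ω]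
    [MeasurableSpace Ω'] [PseudoEMetricSpace X] [MeasurableSpace X] [BorelSpace X]
    {P : Measure Ω} [IsProbabilityMeasure P] {W : Measure Ω'} [IsProbabilityMeasure W]
    {Y : ℕ → Ω → X} {Z : Ω' → X} (hZ : AEMeasurable Z W) (hY : ∀ k, AEMeasurable (Y k) P)
    (hlaw : ∀ g : BoundedContinuousFunction X ℝ,
      Tendsto (fun k ↦ ∫ ω, g (Y k ω) ∂P) atTop (𝓝 (∫ ω, g (Z ω) ∂W)))
    {G : Set X} (hG : IsOpen G) {ε : ℝ} (hε : 0 < ε) :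
    ∀ᶠ k in atTop, (W.map Z).real G - ε < P.real (Y k ⁻¹' G) := by
  have htd : Tendsto (β := ProbabilityMeasure X)
      (fun k ↦ ⟨P.map (Y k), Measure.isProbabilityMeasure_map (hY k)⟩) atTop
      (𝓝 ⟨W.map Z, Measure.isProbabilityMeasure_map hZ⟩) := by
    rw [ProbabilityMeasure.tendsto_iff_forall_integral_tendsto]
    intro g
    simp only [ProbabilityMeasure.coe_mk]
    rw [integral_map hZ g.continuous.aestronglyMeasurable]
    simp_rw [integral_map (hY _) g.continuous.aestronglyMeasurable]
    exact hlaw g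
  have hli := ProbabilityMeasure.le_liminf_measure_open_of_tendsto htd hG
  simp only [ProbabilityMeasure.coe_mk] at hli
  set m : ℝ≥0∞ := W.map Z G with hm
  haveI : IsProbabilityMeasure (W.map Z) := Measure.isProbabilityMeasure_map hZ
  have hm_top : m ≠ ∞ := measure_ne_top _ _
  by_cases hm0 : m.toReal - ε < 0
  · filter_upwards with k
    rw [measureReal_def]
    exact hm0.trans_le ENNReal.toReal_nonneg
  · rw [not_lt] at hm0
    have hmpos : m ≠ 0 := by
      intro h
      rw [h, ENNReal.toReal_zero] at hm0
      linarith
    have hlt : m - ENNReal.ofReal ε < m :=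
      ENNReal.sub_lt_self hm_top hmpos (by simpa using hε)
    have hev : ∀ᶠ k in atTop, m - ENNReal.ofReal ε < P.map (Y k) G :=
      Filter.eventually_lt_of_lt_liminf (hlt.trans_le hli)
    filter_upwards [hev] with k hk
    haveI : IsProbabilityMeasure (P.map (Y k)) := Measure.isProbabilityMeasure_map (hY k)
    have h1 : (m - ENNReal.ofReal ε).toReal < (P.map (Y k) G).toReal :=
      (ENNReal.toReal_lt_toReal (ne_top_of_le_ne_top hm_top tsub_le_self) (measure_ne_top _ _)).2 hk
    have h2 : m.toReal - ε ≤ (m - ENNReal.ofReal ε).toReal := by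
      have := ENNReal.le_toReal_sub (a := m) (b := ENNReal.ofReal ε) ENNReal.ofReal_ne_top
      rwa [ENNReal.toReal_ofReal hε.le] at this
    have h3 : P.map (Y k) G = P (Y k ⁻¹' G) := by
      rw [Measure.map_apply_of_aemeasurable (hY k) hG.measurableSet]
    rw [measureReal_def, measureReal_def, ← h3]
    exact h2.trans_lt h1

/-! ### The composition -/

/-- **Composition (real proof):** the shared lattice dictionary of route `CardyViaSLE6`
(`InterfaceImpliesCrossing`, `CrossingImpliesInterface`, existing items by name) and the two
registered stubs imply the piece `SeqCrossingReadout` BY NAME. -/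
theorem SeqCrossingReadout_of :
    InterfaceImpliesCrossing → CrossingImpliesInterface →
      stub_hitsBeforeUpperApprox → stub_sleTargetSideApprox → SeqCrossingReadout := by
  intro h3 h4 hU hV
  dsimp only [stub_hitsBeforeUpperApprox, stub_sleTargetSideApprox] at hU hV
  intro u f κ hκ hu hf hlim R μ φ x hμ hφ
  classical
  haveI hWprob : IsProbabilityMeasure Literature.Probability.Process.preWienerMeasure :=
    isProbabilityMeasure_preWienerMeasure'
  -- an admissible family of `R.chord 0 2`, its limit SLE_κ curve `Γ`, whose law is `μ`
  obtain ⟨E, hE⟩ :=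
    Summit.CriticalPhenomena.CardyFormulaZ2.Cruxes.LagHandOff.HittingTournament.stub_discretisable
      (R.chord 0 2 (by decide))
  obtain ⟨Γ, hΓ, hconv⟩ := hlim _ E hE
  have hμΓ : μ = Literature.Probability.Process.preWienerMeasure.map Γ :=
    IsSLELaw.unique IsSLECurve.map_eq_holds hμ hΓ.isSLELaw_map
  haveI : IsProbabilityMeasure μ := by
    rw [hμΓ]; exact Measure.isProbabilityMeasure_map hΓ.aemeasurable
  set P : Measure (BondConfig (Site 2)) := bondPercolation (zdGraph 2) half with hP
  set c : ℝ := μ.real (CurveClass.hitsBefore (R.arc 2) (R.arc 1)) with hc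
  set t : ℝ := f (crossRatio x) with ht
  -- the crossing probabilities along `u` tend to `t`
  have hp : Tendsto (fun k ↦ bondDomainCrossingProb R (u k)) atTop (𝓝 t) := hf R φ x hφ
  refine eq_of_forall_dist_le fun e he ↦ ?_
  obtain ⟨ε, hε, hεe⟩ : ∃ ε : ℝ, 0 < ε ∧ 4 * ε ≤ e := ⟨e / 4, by positivity, by linarith⟩
  -- parameters: b from the upper approximation and the lower dictionary, b' from the target-side
  -- approximation, a from the upper dictionary with a ≤ b'
  obtain ⟨b₂, hb₂, hU'⟩ := hU R μ inferInstance ε hε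
  obtain ⟨a₀, ha₀, h3'⟩ := h3 R E hE ε hε
  obtain ⟨b₀, hb₀, h4'⟩ := h4 R E hE ε hε
  obtain ⟨b, hb, hbb₂, hbb₀⟩ : ∃ b : ℝ, 0 < b ∧ b < b₂ ∧ b < b₀ :=
    ⟨min b₂ b₀ / 2, by positivity, by linarith [min_le_left b₂ b₀], by linarith [min_le_right b₂ b₀]⟩
  obtain ⟨b₁, hb₁, hV'⟩ := hV κ hκ R μ hμ ε hε b hb
  obtain ⟨b', hb', hb'b₁⟩ : ∃ b' : ℝ, 0 < b' ∧ b' < b₁ := ⟨b₁ / 2, by positivity, by linarith⟩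
  obtain ⟨a, ha, haa₀, hab'⟩ : ∃ a : ℝ, 0 < a ∧ a < a₀ ∧ a ≤ b' :=
    ⟨min (a₀ / 2) b', by positivity, by linarith [min_le_left (a₀ / 2) b'], min_le_right _ _⟩
  -- the two open events
  set U : Set (CurveClass ℂ) :=
    CurveClass.mk '' CurveClass.hitsBeforeApprox (R.arc 2) (R.arc 1) a b with hUdef
  set V : Set (CurveClass ℂ) :=
    CurveClass.mk '' CurveClass.hitsBeforeApprox (R.arc 1) (R.arc 2) b b' with hVdef
  have hUo : IsOpen U :=
    SeparationQuotient.isOpenMap_mk _ (CurveClass.isOpen_hitsBeforeApprox _ _ _ _)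
  have hVo : IsOpen V :=
    SeparationQuotient.isOpenMap_mk _ (CurveClass.isOpen_hitsBeforeApprox _ _ _ _)
  have hUV : Disjoint U V := disjoint_image_hitsBeforeApprox hab' le_rfl
  -- the two approximations under `μ`
  have eS1 : c ≤ μ.real U + ε := hU' b ⟨hb, hbb₂⟩ a ha
  have eS2 : μ.real univ ≤ μ.real V + c + ε := hV' b' ⟨hb', hb'b₁⟩
  have huniv : μ.real univ = 1 := probReal_univ
  -- the interfaces along `u`
  set X : ℕ → BondConfig (Site 2) → CurveClass ℂ := fun k ↦
    Literature.Probability.Percolation.bondInterfaceIn (R.chord 0 2 (by decide)) (E (u k)) with hXdef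
  have hXm : ∀ k, AEMeasurable (X k) P := fun k ↦ (measurable_bondInterfaceIn _ _).aemeasurable
  have hconv' : ∀ g : BoundedContinuousFunction (CurveClass ℂ) ℝ,
      Tendsto (fun k ↦ ∫ ω, g (X k ω) ∂P) atTop
        (𝓝 (∫ ω, g (Γ ω) ∂Literature.Probability.Process.preWienerMeasure)) := hconv
  -- portmanteau for the two open events (laws of `Γ` = `μ`)
  have hpU := eventually_lt_measureReal_preimage_of_tendsto_atTop hΓ.aemeasurable hXm hconv' hUo hε
  have hpV := eventually_lt_measureReal_preimage_of_tendsto_atTop hΓ.aemeasurable hXm hconv' hVo hε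
  rw [← hμΓ] at hpU hpV
  -- the lattice dictionary, eventually along `u`
  have h3e := hu.eventually (h3' a ⟨ha, haa₀⟩ b hb)
  have h4e := hu.eventually (h4' b ⟨hb, hbb₀⟩ a ha)
  -- the crossing probabilities are eventually `ε`-close to `t`
  have hpe : ∀ᶠ k in atTop, dist (bondDomainCrossingProb R (u k)) t < ε :=
    Metric.tendsto_nhds.1 hp ε hε
  obtain ⟨k, hk⟩ := (h3e.and (h4e.and (hpU.and (hpV.and hpe)))).exists
  obtain ⟨hk3, hk4, hkU, hkV, hkp⟩ := hk
  -- restate at this `k`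
  have e3 : P.real (X k ⁻¹' U) ≤ bondDomainCrossingProb R (u k) + ε := hk3
  have e4 : bondDomainCrossingProb R (u k) ≤ P.real (X k ⁻¹' U) + ε := hk4
  have eU : μ.real U - ε < P.real (X k ⁻¹' U) := hkU
  have eV : μ.real V - ε < P.real (X k ⁻¹' V) := hkV
  have ep : dist (bondDomainCrossingProb R (u k)) t < ε := hkp
  rw [Real.dist_eq, abs_sub_lt_iff] at ep
  -- disjointness in probability
  have hsum : P.real (X k ⁻¹' U) + P.real (X k ⁻¹' V) ≤ 1 := by
    have hAB : P (X k ⁻¹' U) + P (X k ⁻¹' V) ≤ 1 := by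
      rw [← measure_union₀ ((hXm k).nullMeasurableSet_preimage hVo.measurableSet)
        (hUV.preimage _).aedisjoint]
      exact prob_le_one
    rw [measureReal_def, measureReal_def,
      ← ENNReal.toReal_add (measure_ne_top _ _) (measure_ne_top _ _)]
    calc _ ≤ (1 : ℝ≥0∞).toReal := ENNReal.toReal_mono ENNReal.one_ne_top hAB
      _ = 1 := by simp
  rw [Real.dist_eq]
  refine le_trans (le_of_lt ?_) hεe
  rw [abs_sub_lt_iff]
  constructor <;> linarith

/-- The piece, conditionally on the two shared dictionary items and the two registered stubs. -/
theorem seqCrossingReadout_of_items_and_stubs (h3 : InterfaceImpliesCrossing)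
    (h4 : CrossingImpliesInterface) : SeqCrossingReadout :=
  SeqCrossingReadout_of h3 h4 Holds.stub_hitsBeforeUpperApprox Holds.stub_sleTargetSideApprox

end Summit.CriticalPhenomena.CardyFormulaZ2.Cruxes.CardyRigiditySeq.BirthSeqCrossingReadout

end

/-!
# Birth skeleton (BC3) for piece X₃ `SeqLimitTargetIndependent` of the split of `CardyRigiditySeq` (stmt-CriticalPhenomena-4680)

Route `CardyExpCovariance`; the piece is a child of the crux `CardyRigiditySeq` in the
strategist's children.json (the route decl does not exist yet, so it is restated verbatim here).

    SeqLimitTargetIndependent := ∀ u κ, 0 < κ → u_k → 0⁺ → LIMSEQ κ u →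
      ∃ Q : ChordalFamily, (∀ D, IsSLELaw κ D (Q D)) ∧ Q.IsTargetIndependent

"locality of percolation, in Lawler–Schramm–Werner's SPLITTING form, survives the sequential
scaling limit".  Cut along lattice / limit:

* `stub_handsOffThickSplitting` (LATTICE, exact; size M/L): every three-marked domain
  `(D; a, b, b')` carries a HANDS-OFF PAIR of admissible discretisation families `E₁` of
  `(D; a, b)` and `E₂` of `(D; a, b')` — identical except on the stretch `[b, b']` — whose
  interfaces, stopped on the closed `r`-neighbourhood of `[b, b'] = D.arc 1`, have the SAME LAW at
  every small mesh (the two explorations coincide edge by edge until they first examine a boundary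
  edge of `[b, b']`, by which time both are inside the neighbourhood; cf. the `LagHandOff`
  machinery of route `CardySelfRefinement`).
* `stub_stoppedLawsConverge` (LIMIT; size L, pure curve-space measure theory): if the interfaces
  of an admissible family converge in law along `u` to a random curve `Γ`, then for every closed
  `F` and Lebesgue-a.e. radius `r > 0` the curves stopped on `cthickening r F` converge in law to
  `stopAt (cthickening r F) ∘ Γ` (for each curve class the bad radii — discontinuity levels of the
  monotone map `r ↦ hitParam (cthickening r F)` — are countable, so a.e. level is an a.s.
  continuity level of the stopping map; continuous-mapping theorem).

Composition `SeqLimitTargetIndependent_of` (real proof, the measure theory done HERE): SLE_κ laws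
in every Dobrushin domain from `LIMSEQ` and the LANDED existence of admissible families
(`…LagHandOff.HittingTournament.stub_discretisable`); uniqueness of the SLE_κ law
(`IsSLELaw.unique`, `IsSLECurve.map_eq_holds`) identifies the family on the two chords with the
laws of the limit curves `Γ₁, Γ₂` of the hands-off pair; for every `n` a radius
`r n ∈ (0, 1/(n+1))` good for BOTH families is picked off the two null sets (`exists_seq_good`);
the stopped laws of `Γ₁, Γ₂` on `cthickening (r n) (D.arc 1)` agree (limits of eventually equal
sequences, `ext_of_forall_integral_eq_of_IsFiniteMeasure`), and the tree's
`measure_preimage_stopAt_eq_of_shrinking` (closed sets shrinking to `D.arc 1`) passes the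
agreement to `stopAt (D.arc 1)`: target independence.
-/

noncomputable section

namespace Summit.CriticalPhenomena.CardyFormulaZ2.Cruxes.CardyRigiditySeq.BirthSeqLimitTargetIndependent

open scoped NNReal Topology ENNReal
open MeasureTheory Filter Set Metric
open Literature.Probability.RandomPlanarGeometry Literature.Probability.LatticeModels
open Literature.Probability.Percolation (bondPercolation half BondConfig measurable_bondInterfaceIn)

/-- Piece X₃ of the split of `CardyRigiditySeq`, restated VERBATIM from the strategist's
children.json. -/
def SeqLimitTargetIndependent : Prop :=
  ∀ (u : ℕ → ℝ) (κ : NNReal), 0 < κ → Filter.Tendsto u Filter.atTop (nhdsWithin 0 (Set.Ioi 0)) → (∀ (D : Literature.Probability.RandomPlanarGeometry.DobrushinDomain) (E : ℝ → Literature.Probability.LatticeModels.DiscreteDobrushin), Literature.Probability.LatticeModels.ZdDiscretisationFamily D E → ∃ Γ : (NNReal → ℝ) → Literature.Probability.RandomPlanarGeometry.CurveClass ℂ, Literature.Probability.RandomPlanarGeometry.IsSLECurve κ D Γ ∧ ∀ g : BoundedContinuousFunction (Literature.Probability.RandomPlanarGeometry.CurveClass ℂ) ℝ, Filter.Tendsto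 (fun k ↦ ∫ ω, g (Literature.Probability.Percolation.bondInterfaceIn D (E (u k)) ω) ∂(Literature.Probability.Percolation.bondPercolation (Literature.Probability.LatticeModels.zdGraph 2) Literature.Probability.Percolation.half)) Filter.atTop (nhds (∫ ω, g (Γ ω) ∂Literature.Probability.Process.preWienerMeasure))) → ∃ Q : Literature.Probability.RandomPlanarGeometry.ChordalFamily, (∀ D : Literature.Probability.RandomPlanarGeometry.DobrushinDomain, Literature.Probability.RandomPlanarGeometry.IsSLELaw κ D (Q D)) ∧ Q.IsTargetIndependent

/-- STUB A — **hands-off pairs: exact lattice splitting before the thickened far arc** (LSW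
locality at the lattice level; size M/L). -/
protected theorem Holds.stub_handsOffThickSplitting :
    ∀ (D : Literature.Probability.RandomPlanarGeometry.MarkedDomain 3), ∃ (E₁ E₂ : ℝ → Literature.Probability.LatticeModels.DiscreteDobrushin), Literature.Probability.LatticeModels.ZdDiscretisationFamily (D.chord 0 1 (by decide)) E₁ ∧ Literature.Probability.LatticeModels.ZdDiscretisationFamily (D.chord 0 2 (by decide)) E₂ ∧ ∀ r : ℝ, 0 < r → ∀ᶠ δ in nhdsWithin (0:ℝ) (Set.Ioi 0), MeasureTheory.Measure.map (fun ω ↦ Literature.Probability.RandomPlanarGeometry.CurveClass.stopAt (Metric.cthickening r (D.arc 1)) (Literature.Probability.Percolation.bondInterfaceIn (D.chord 0 1 (by decide)) (E₁ δ) ω)) (Literature.Probability.Percolation.bondPercolation (Literature.Probability.LatticeModels.zdGraph 2) Literature.Probability.Percolation.half) = MeasureTheory.Measure.map (fun ω ↦ Literature.Probability.RandomPlanarGeometry.CurveClass.stopAt (Metric.cthickening r (D.arc 1)) (Literature.Probability.Percolation.bondInterfaceIn (D.chord 0 2 (by decide)) (E₂ δ) ω)) (Literature.Probability.Percolation.bondPercolation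 (Literature.Probability.LatticeModels.zdGraph 2) Literature.Probability.Percolation.half) := by
  sorry

/-- By-name handle of the registered stub `Holds.stub_handsOffThickSplitting`. -/
def stub_handsOffThickSplitting : Prop := type_of% Holds.stub_handsOffThickSplitting

/-- STUB B — **stopped laws converge at almost every thickening level** (curve-space measure
theory: a.e. level of `r ↦ hitParam (cthickening r F)` is an a.s. continuity level of the stopping
map; continuous mapping along `u`; size L). -/
protected theorem Holds.stub_stoppedLawsConverge :
    ∀ (u : ℕ → ℝ) (κ : NNReal), 0 < κ → Filter.Tendsto u Filter.atTop (nhdsWithin 0 (Set.Ioi 0)) → ∀ (D : Literature.Probability.RandomPlanarGeometry.DobrushinDomain) (E : ℝ → Literature.Probability.LatticeModels.DiscreteDobrushin), Literature.Probability.LatticeModels.ZdDiscretisationFamily D E → ∀ Γ : (NNReal → ℝ) → Literature.Probability.RandomPlanarGeometry.CurveClass ℂ, Literature.Probability.RandomPlanarGeometry.IsSLECurve κ D Γ → (∀ g : BoundedContinuousFunction (Literature.Probability.RandomPlanarGeometry.CurveClass ℂ) ℝ, Filter.Tendsto (fun k ↦ ∫ ω, g (Literature.Probability.Percolation.bondInterfaceIn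 D (E (u k)) ω) ∂(Literature.Probability.Percolation.bondPercolation (Literature.Probability.LatticeModels.zdGraph 2) Literature.Probability.Percolation.half)) Filter.atTop (nhds (∫ ω, g (Γ ω) ∂Literature.Probability.Process.preWienerMeasure))) → ∀ F : Set ℂ, IsClosed F → ∀ᵐ (r : ℝ) ∂MeasureTheory.volume, 0 < r → ∀ g : BoundedContinuousFunction (Literature.Probability.RandomPlanarGeometry.CurveClass ℂ) ℝ, Filter.Tendsto (fun k ↦ ∫ ω, g (Literature.Probability.RandomPlanarGeometry.CurveClass.stopAt (Metric.cthickening r F) (Literature.Probability.Percolation.bondInterfaceIn D (E (u k)) ω)) ∂(Literature.Probability.Percolation.bondPercolation (Literature.Probability.LatticeModels.zdGraph 2) Literature.Probability.Percolation.half)) Filter.atTop (nhds (∫ ω, g (Literature.Probability.RandomPlanarGeometry.CurveClass.stopAt (Metric.cthickening r F) (Γ ω)) ∂Literature.Probability.Process.preWienerMeasure)) := by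
  sorry

/-- By-name handle of the registered stub `Holds.stub_stoppedLawsConverge`. -/
def stub_stoppedLawsConverge : Prop := type_of% Holds.stub_stoppedLawsConverge

/-- From two Lebesgue-a.e. properties on `ℝ` pick, for every `n`, a radius in `(0, 1/(n+1))`
enjoying both. -/
theorem exists_seq_good {P₁ P₂ : ℝ → Prop} (h₁ : ∀ᵐ (r : ℝ) ∂volume, P₁ r)
    (h₂ : ∀ᵐ (r : ℝ) ∂volume, P₂ r) :
    ∃ r : ℕ → ℝ, ∀ n : ℕ, r n ∈ Ioo (0 : ℝ) (1 / ((n : ℝ) + 1)) ∧ P₁ (r n) ∧ P₂ (r n) := by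
  have key : ∀ n : ℕ, ∃ x, x ∈ Ioo (0 : ℝ) (1 / ((n : ℝ) + 1)) ∧ P₁ x ∧ P₂ x := by
    intro n
    have hε : (0 : ℝ) < 1 / ((n : ℝ) + 1) := by positivity
    have hne : volume.restrict (Ioo (0 : ℝ) (1 / ((n : ℝ) + 1))) ≠ 0 := by
      intro h0
      have h1 : volume.restrict (Ioo (0 : ℝ) (1 / ((n : ℝ) + 1))) univ = 0 := by
        rw [h0]; simp
      rw [Measure.restrict_apply_univ, Real.volume_Ioo, sub_zero, ENNReal.ofReal_eq_zero] at h1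
      linarith
    haveI : (ae (volume.restrict (Ioo (0 : ℝ) (1 / ((n : ℝ) + 1))))).NeBot := ae_neBot.2 hne
    have hmem : ∀ᵐ x ∂(volume.restrict (Ioo (0 : ℝ) (1 / ((n : ℝ) + 1)))),
        x ∈ Ioo (0 : ℝ) (1 / ((n : ℝ) + 1)) := ae_restrict_mem measurableSet_Ioo
    obtain ⟨x, hx, hx₁, hx₂⟩ := (hmem.and ((ae_restrict_of_ae h₁).and (ae_restrict_of_ae h₂))).exists
    exact ⟨x, hx, hx₁, hx₂⟩
  choose r hr using key
  exact ⟨r, hr⟩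

/-- **Composition (real proof):** the two stubs imply the piece `SeqLimitTargetIndependent` BY
NAME (see the module docstring). -/
theorem SeqLimitTargetIndependent_of :
    stub_handsOffThickSplitting → stub_stoppedLawsConverge → SeqLimitTargetIndependent := by
  intro hA hB
  dsimp only [stub_handsOffThickSplitting, stub_stoppedLawsConverge] at hA hB
  intro u κ hκ hu hlim
  classical
  haveI hWprob : IsProbabilityMeasure Literature.Probability.Process.preWienerMeasure :=
    isProbabilityMeasure_preWienerMeasure'
  -- SLE_κ laws exist in every Dobrushin domain: LIMSEQ + admissible families exist (landed theorem)
  have hex : ∀ D : DobrushinDomain, ∃ μ : Measure (CurveClass ℂ), IsSLELaw κ D μ := by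
    intro D
    obtain ⟨E, hE⟩ :=
      Summit.CriticalPhenomena.CardyFormulaZ2.Cruxes.LagHandOff.HittingTournament.stub_discretisable D
    obtain ⟨Γ, hΓ, -⟩ := hlim D E hE
    exact ⟨_, hΓ.isSLELaw_map⟩
  choose Q hQ using hex
  refine ⟨Q, hQ, ?_⟩
  intro D T hT
  -- the hands-off pair and its two limit curves
  obtain ⟨E₁, E₂, hE₁, hE₂, hsplit⟩ := hA D
  obtain ⟨Γ₁, hΓ₁, hc₁⟩ := hlim _ E₁ hE₁
  obtain ⟨Γ₂, hΓ₂, hc₂⟩ := hlim _ E₂ hE₂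
  have hQ₁ : Q (D.chord 0 1 (by decide)) = Literature.Probability.Process.preWienerMeasure.map Γ₁ :=
    IsSLELaw.unique IsSLECurve.map_eq_holds (hQ _) hΓ₁.isSLELaw_map
  have hQ₂ : Q (D.chord 0 2 (by decide)) = Literature.Probability.Process.preWienerMeasure.map Γ₂ :=
    IsSLELaw.unique IsSLECurve.map_eq_holds (hQ _) hΓ₂.isSLELaw_map
  rw [hQ₁, hQ₂]
  have hF : IsClosed (D.arc 1) := D.isClosed_arc 1
  -- radii good for both families, `r n ∈ (0, 1/(n+1))`
  obtain ⟨r, hr⟩ := exists_seq_good (hB u κ hκ hu _ E₁ hE₁ Γ₁ hΓ₁ hc₁ (D.arc 1) hF)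
    (hB u κ hκ hu _ E₂ hE₂ Γ₂ hΓ₂ hc₂ (D.arc 1) hF)
  -- the stopping sets `cthickening (r n) (D.arc 1)` are closed, contain the arc and shrink to it
  have hS : ∀ n, IsClosed (cthickening (r n) (D.arc 1)) := fun n ↦ isClosed_cthickening
  have hFS : ∀ n, D.arc 1 ⊆ cthickening (r n) (D.arc 1) := fun n ↦ self_subset_cthickening _
  have hr0 : Tendsto r atTop (𝓝 0) :=
    tendsto_of_tendsto_of_tendsto_of_le_of_le tendsto_const_nhds
      tendsto_one_div_add_atTop_nhds_zero_nat (fun n ↦ (hr n).1.1.le) (fun n ↦ (hr n).1.2.le)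
  have hshrink : ∀ φ : ℕ → ℕ, Tendsto φ atTop atTop → ∀ z : ℕ → ℂ,
      (∀ k, z k ∈ cthickening (r (φ k)) (D.arc 1)) → ∀ x : ℂ, Tendsto z atTop (𝓝 x) → x ∈ D.arc 1 := by
    intro φ hφ z hz x hx
    rw [Metric.mem_iff_infEDist_zero_of_closed hF]
    refine le_antisymm ?_ zero_le
    have h1 : Tendsto (fun k ↦ Metric.infEDist (z k) (D.arc 1)) atTop
        (𝓝 (Metric.infEDist x (D.arc 1))) :=
      (Metric.continuous_infEDist.tendsto x).comp hx
    have h2 : Tendsto (fun k ↦ ENNReal.ofReal (r (φ k))) atTop (𝓝 0) := by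
      simpa using ENNReal.tendsto_ofReal (hr0.comp hφ)
    exact le_of_tendsto_of_tendsto' h1 h2 fun k ↦ mem_cthickening_iff.1 (hz k)
  have hmS : ∀ n, Measurable (CurveClass.stopAt (cthickening (r n) (D.arc 1)) :
      CurveClass ℂ → CurveClass ℂ) := fun n ↦ CurveClass.measurable_stopAt (hS n)
  -- the stopped laws of `Γ₁`, `Γ₂` agree on every `cthickening (r n) (D.arc 1)`
  have hEq : ∀ (n : ℕ) (T' : Set (CurveClass ℂ)), MeasurableSet T' →
      (Literature.Probability.Process.preWienerMeasure.map Γ₁)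
          (CurveClass.stopAt (cthickening (r n) (D.arc 1)) ⁻¹' T') =
        (Literature.Probability.Process.preWienerMeasure.map Γ₂)
          (CurveClass.stopAt (cthickening (r n) (D.arc 1)) ⁻¹' T') := by
    intro n T' hT'
    have hG₁ := (hr n).2.1 (hr n).1.1
    have hG₂ := (hr n).2.2 (hr n).1.1
    have hlaw : Literature.Probability.Process.preWienerMeasure.map
          (CurveClass.stopAt (cthickening (r n) (D.arc 1)) ∘ Γ₁) =
        Literature.Probability.Process.preWienerMeasure.map
          (CurveClass.stopAt (cthickening (r n) (D.arc 1)) ∘ Γ₂) := by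
      refine ext_of_forall_integral_eq_of_IsFiniteMeasure fun g ↦ ?_
      rw [integral_map ((hmS n).comp_aemeasurable hΓ₁.aemeasurable) g.continuous.aestronglyMeasurable,
        integral_map ((hmS n).comp_aemeasurable hΓ₂.aemeasurable) g.continuous.aestronglyMeasurable]
      simp only [Function.comp_apply]
      refine tendsto_nhds_unique_of_eventuallyEq (hG₁ g) (hG₂ g) ?_
      filter_upwards [hu.eventually (hsplit (r n) (hr n).1.1)] with k hk
      have hm₁ : AEMeasurable (fun ω ↦ CurveClass.stopAt (cthickening (r n) (D.arc 1))
          (Literature.Probability.Percolation.bondInterfaceIn (D.chord 0 1 (by decide)) (E₁ (u k)) ω))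
          (bondPercolation (zdGraph 2) half) :=
        ((hmS n).comp (measurable_bondInterfaceIn _ _)).aemeasurable
      have hm₂ : AEMeasurable (fun ω ↦ CurveClass.stopAt (cthickening (r n) (D.arc 1))
          (Literature.Probability.Percolation.bondInterfaceIn (D.chord 0 2 (by decide)) (E₂ (u k)) ω))
          (bondPercolation (zdGraph 2) half) :=
        ((hmS n).comp (measurable_bondInterfaceIn _ _)).aemeasurable
      have e₁ : ∫ γ, g γ ∂((bondPercolation (zdGraph 2) half).map (fun ω ↦
            CurveClass.stopAt (cthickening (r n) (D.arc 1))
              (Literature.Probability.Percolation.bondInterfaceIn (D.chord 0 1 (by decide)) (E₁ (u k)) ω))) =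
          ∫ ω, g (CurveClass.stopAt (cthickening (r n) (D.arc 1))
            (Literature.Probability.Percolation.bondInterfaceIn (D.chord 0 1 (by decide)) (E₁ (u k)) ω))
            ∂(bondPercolation (zdGraph 2) half) :=
        integral_map hm₁ g.continuous.aestronglyMeasurable
      have e₂ : ∫ γ, g γ ∂((bondPercolation (zdGraph 2) half).map (fun ω ↦
            CurveClass.stopAt (cthickening (r n) (D.arc 1))
              (Literature.Probability.Percolation.bondInterfaceIn (D.chord 0 2 (by decide)) (E₂ (u k)) ω))) =
          ∫ ω, g (CurveClass.stopAt (cthickening (r n) (D.arc 1))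
            (Literature.Probability.Percolation.bondInterfaceIn (D.chord 0 2 (by decide)) (E₂ (u k)) ω))
            ∂(bondPercolation (zdGraph 2) half) :=
        integral_map hm₂ g.continuous.aestronglyMeasurable
      rw [← e₁, ← e₂, hk]
    have h := congrArg (fun ρ : Measure (CurveClass ℂ) ↦ ρ T') hlaw
    rw [Measure.map_apply_of_aemeasurable ((hmS n).comp_aemeasurable hΓ₁.aemeasurable) hT',
      Measure.map_apply_of_aemeasurable ((hmS n).comp_aemeasurable hΓ₂.aemeasurable) hT'] at h
    rw [Measure.map_apply_of_aemeasurable hΓ₁.aemeasurable ((hmS n) hT'),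
      Measure.map_apply_of_aemeasurable hΓ₂.aemeasurable ((hmS n) hT')]
    exact h
  exact measure_preimage_stopAt_eq_of_shrinking hF hS hFS hshrink hEq hT

/-- The piece, conditionally on the two registered stubs (the only `sorry`s of this file are
inside `Holds.stub_*`). -/
theorem seqLimitTargetIndependent_of_stubs : SeqLimitTargetIndependent :=
  SeqLimitTargetIndependent_of Holds.stub_handsOffThickSplitting Holds.stub_stoppedLawsConverge

end Summit.CriticalPhenomena.CardyFormulaZ2.Cruxes.CardyRigiditySeq.BirthSeqLimitTargetIndependent

end

/-! ## The registered skeleton: six stubs + two shared items ⟹ the crux, BY NAME -/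

noncomputable section

namespace Summit.CriticalPhenomena.CardyFormulaZ2.Cruxes.CardyRigiditySeq.SplitSkeleton

open Summit.CriticalPhenomena.CardyFormulaZ2.Cruxes.CardyRigiditySeq

/-- **Composition (real proof): the crux `CardyRigiditySeq` BY NAME from the six registered stubs and
the two shared dictionary items of route `CardyViaSLE6`** — X₁ from `stub_subseqLimitLaw`,
`stub_subseqLimitIsSLE`; X₂ from stmt-11317, stmt-11318, `stub_hitsBeforeUpperApprox`,
`stub_sleTargetSideApprox`; X₃ from `stub_handsOffThickSplitting`, `stub_stoppedLawsConverge`; then the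
proved assembly `Glue.cardyRigiditySeq_of_subs_unfolded`. -/
theorem CardyRigiditySeq_of :
    BirthSeqKernelForcesSLE.stub_subseqLimitLaw → BirthSeqKernelForcesSLE.stub_subseqLimitIsSLE →
      Summit.CriticalPhenomena.CardyFormulaZ2.Theses.CardyViaSLE6.InterfaceImpliesCrossing →
      Summit.CriticalPhenomena.CardyFormulaZ2.Theses.CardyViaSLE6.CrossingImpliesInterface →
      BirthSeqCrossingReadout.stub_hitsBeforeUpperApprox → BirthSeqCrossingReadout.stub_sleTargetSideApprox →
      BirthSeqLimitTargetIndependent.stub_handsOffThickSplitting →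
      BirthSeqLimitTargetIndependent.stub_stoppedLawsConverge →
      Summit.CriticalPhenomena.CardyFormulaZ2.Theses.CardyExpCovariance.CardyRigiditySeq := by
  intro hT hI h3 h4 hU hV hA hB
  have hX₁ := BirthSeqKernelForcesSLE.SeqKernelForcesSLE_of hT hI
  have hX₂ := BirthSeqCrossingReadout.SeqCrossingReadout_of h3 h4 hU hV
  have hX₃ := BirthSeqLimitTargetIndependent.SeqLimitTargetIndependent_of hA hB
  dsimp only [BirthSeqKernelForcesSLE.SeqKernelForcesSLE, BirthSeqCrossingReadout.SeqCrossingReadout,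
    BirthSeqLimitTargetIndependent.SeqLimitTargetIndependent] at hX₁ hX₂ hX₃
  intro u f hu hf
  exact Glue.cardyRigiditySeq_of_subs_unfolded hX₁ hX₂ hX₃ u f hu hf

/-- The crux conditionally on the two shared items, with the six registered stubs plugged in
(depends on `sorryAx` ONLY through the `Holds.stub_*`; certifies mechanically that the by-name
handles ARE the stub statements). -/
theorem cardyRigiditySeq_of_items_and_stubs
    (h3 : Summit.CriticalPhenomena.CardyFormulaZ2.Theses.CardyViaSLE6.InterfaceImpliesCrossing)
    (h4 : Summit.CriticalPhenomena.CardyFormulaZ2.Theses.CardyViaSLE6.CrossingImpliesInterface) :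
    Summit.CriticalPhenomena.CardyFormulaZ2.Theses.CardyExpCovariance.CardyRigiditySeq :=
  CardyRigiditySeq_of BirthSeqKernelForcesSLE.Holds.stub_subseqLimitLaw
    BirthSeqKernelForcesSLE.Holds.stub_subseqLimitIsSLE h3 h4
    BirthSeqCrossingReadout.Holds.stub_hitsBeforeUpperApprox BirthSeqCrossingReadout.Holds.stub_sleTargetSideApprox
    BirthSeqLimitTargetIndependent.Holds.stub_handsOffThickSplitting
    BirthSeqLimitTargetIndependent.Holds.stub_stoppedLawsConverge

end Summit.CriticalPhenomena.CardyFormulaZ2.Cruxes.CardyRigiditySeq.SplitSkeleton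

end
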